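import Mathlib.Analysis.Calculus.ContDiff.Basic
import Mathlib.Analysis.Normed.Group.Bounded
import Literature.Geometry.Lorentzian.AdiabaticKerrSchildBackground

/-!
# Uniform joint-derivative bounds for the Kerr–Schild background on the compact spin box

Leg (β) ("the background never degenerates") of the line `polynomial-closure` for the crux
`NearExtremalKappaCapture` (route `PhaseMixingCapture`): for `0 < M`, every order `n` and every
radius `R` there is ONE constant `B ≥ 1` such that, for every spin `|a| ≤ M` (the extremal member
included) and every point `x` of the slice `{x⁰ = 0}` with `M ≤ r_a(x) ≤ R`, all joint
`(a, x)`-derivatives of order `j ≤ n` of the Kerr–Schild scalar `(a, x) ↦ H_{M,a}(x)`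
(`Kerr.scalarH`) and of the null-covector components `(a, x) ↦ ℓ_μ(a, x)`
(`Kerr.nullCovectorFun`) have operator norm at most `B`.

Proof: the box `{(a, x) | |a| ≤ M, x⁰ = 0, M ≤ r_a(x) ≤ R} ⊆ ℝ × E4` is compact (closed, by joint
continuity of the Kerr–Schild radius; bounded, by `‖x⃗‖² − a² ≤ r²`) and, since `r ≥ M > 0` on
it, lies in the open set on which both families are jointly `C^∞`
(`Kerr.contDiffAt_scalarH_comp`, `Kerr.contDiffAt_nullCovectorFun_comp`); so every iterated
Fréchet derivative is continuous there (`ContDiffAt.continuousAt_iteratedFDeriv`) and bounded on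
the box (`IsCompact.exists_bound_of_continuousOn`); `B` is `max 1` of the sum of the finitely many
individual bounds. Pure calculus and compactness; no named fact is used.
-/

noncomputable section

namespace Summit.FinalStateConjecture.FinalStateConjecture.Theorems.NearExtremalKappaCapture.PolynomialClosure

open Literature.Geometry.Lorentzian
open scoped ContDiff Topology

/-- The Kerr–Schild radius `r_a(x)` is jointly continuous in `(a, x)` (polynomials and square
roots). -/
private theorem continuous_radius_uncurry :
    Continuous fun q : ℝ × E4 ↦ Kerr.radius q.1 q.2 := by
  unfold Kerr.radius E4.spatialNorm
  fun_prop

/-- A point of the slice `{x⁰ = 0}` with `r_a(x) ≤ R`, `|a| ≤ M`, has `‖x‖ ≤ M + |R|`: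
`‖x‖² = ‖x⃗‖² ≤ r² + a² ≤ R² + M²` (`Kerr.spatialNorm_sq_sub_sq_le_radius_sq`). -/
private theorem norm_le_of_radius_le {M a R : ℝ} {x : E4} (hM : 0 < M) (ha : |a| ≤ M)
    (hx0 : x 0 = 0) (hx2 : Kerr.radius a x ≤ R) : ‖x‖ ≤ M + |R| := by
  have h1 : ‖x‖ ^ 2 = E4.spatialNorm x ^ 2 := by
    rw [EuclideanSpace.real_norm_sq_eq, Fin.sum_univ_four, hx0, E4.spatialNorm_sq]
    ring
  have h2 := Kerr.spatialNorm_sq_sub_sq_le_radius_sq a x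
  have h3 : a ^ 2 ≤ M ^ 2 := sq_le_sq' (abs_le.1 ha).1 (abs_le.1 ha).2
  have h4 : Kerr.radius a x ^ 2 ≤ R ^ 2 := by
    nlinarith [Kerr.radius_nonneg a x]
  have h5 : ‖x‖ ^ 2 ≤ (M + |R|) ^ 2 := by
    nlinarith [sq_abs R, abs_nonneg R]
  exact (sq_le_sq₀ (norm_nonneg _) (by positivity)).1 h5

/-- **The compact box.** For `0 < M` there is a compact subset of `ℝ × E4` on which the
Kerr–Schild radius is positive and which contains every `(a, x)` with `|a| ≤ M`, `x⁰ = 0`,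
`M ≤ r_a(x) ≤ R` (namely the set of exactly these pairs: closed by joint continuity of `r`,
bounded by `norm_le_of_radius_le`, compact since `ℝ × E4` is proper). -/
private theorem exists_isCompact_box {M : ℝ} (hM : 0 < M) (R : ℝ) :
    ∃ K : Set (ℝ × E4), IsCompact K ∧ (∀ q ∈ K, 0 < Kerr.radius q.1 q.2) ∧
      ∀ a : ℝ, |a| ≤ M → ∀ x : E4, x 0 = 0 → M ≤ Kerr.radius a x → Kerr.radius a x ≤ R →
        (a, x) ∈ K := by
  refine ⟨{q | |q.1| ≤ M ∧ q.2 0 = 0 ∧ M ≤ Kerr.radius q.1 q.2 ∧ Kerr.radius q.1 q.2 ≤ R}, ?_,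
    fun q hq ↦ hM.trans_le hq.2.2.1, fun a ha x hx0 hx1 hx2 ↦ ⟨ha, hx0, hx1, hx2⟩⟩
  refine Metric.isCompact_of_isClosed_isBounded ?_ ?_
  · have hr : Continuous fun q : ℝ × E4 ↦ Kerr.radius q.1 q.2 := continuous_radius_uncurry
    have h0 : Continuous fun q : ℝ × E4 ↦ q.2 0 :=
      (Kerr.contDiff_coord 0 (n := 0)).continuous.comp continuous_snd
    have ha : Continuous fun q : ℝ × E4 ↦ |q.1| := continuous_abs.comp continuous_fst
    exact (isClosed_le ha continuous_const).inter <| (isClosed_eq h0 continuous_const).inter <|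
      (isClosed_le continuous_const hr).inter (isClosed_le hr continuous_const)
  · rw [isBounded_iff_forall_norm_le]
    refine ⟨M + |R|, ?_⟩
    rintro q ⟨ha, hx0, -, hx2⟩
    rw [Prod.norm_def]
    refine max_le ?_ (norm_le_of_radius_le hM ha hx0 hx2)
    rw [Real.norm_eq_abs]
    linarith [abs_nonneg R]

/-- On a compact set contained in the `C^∞` locus of a real function, every iterated Fréchet
derivative is bounded. -/
private theorem exists_bound_iteratedFDeriv {F : Type*} [NormedAddCommGroup F] [NormedSpace ℝ F]
    {K : Set F} (hK : IsCompact K) {f : F → ℝ} (hf : ∀ q ∈ K, ContDiffAt ℝ ∞ f q) (j : ℕ) :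
    ∃ C : ℝ, ∀ q ∈ K, ‖iteratedFDeriv ℝ j f q‖ ≤ C :=
  hK.exists_bound_of_continuousOn fun q hq ↦
    ((hf q hq).continuousAt_iteratedFDeriv (mod_cast le_top)).continuousWithinAt

/-- **Leg (β) of the line `polynomial-closure`: the Kerr–Schild background never degenerates on
the closed spin box.** For `0 < M`, every order `n` and radius `R` there is one `B ≥ 1` such that
for every `|a| ≤ M`, every `x` with `x⁰ = 0` and `M ≤ r_a(x) ≤ R`, and every `j ≤ n`, the `j`-th
joint `(a, x)`-Fréchet derivatives of `(a, x) ↦ H_{M,a}(x)` and of `(a, x) ↦ ℓ_μ(a, x)`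
(`μ = 0, …, 3`) at `(a, x)` have operator norm at most `B`. Compactness of the box inside the joint
smoothness domain `{r > 0}`; no named fact involved. -/
theorem stub_backgroundUniform :
    ∀ M : ℝ, 0 < M → ∀ (n : ℕ) (R : ℝ), ∃ B : ℝ, 1 ≤ B ∧ ∀ a : ℝ, |a| ≤ M →
      ∀ x : E4, x 0 = 0 → M ≤ Kerr.radius a x → Kerr.radius a x ≤ R → ∀ j : ℕ, j ≤ n →
        ‖iteratedFDeriv ℝ j (fun q : ℝ × E4 ↦ Kerr.scalarH M q.1 q.2) (a, x)‖ ≤ B ∧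
          ∀ μ : Fin 4,
            ‖iteratedFDeriv ℝ j (fun q : ℝ × E4 ↦ Kerr.nullCovectorFun q.1 q.2 μ) (a, x)‖ ≤ B := by
  intro M hM n R
  obtain ⟨K, hKc, hKpos, hKmem⟩ := exists_isCompact_box hM R
  -- joint smoothness of the two families at every point of the box (`r ≥ M > 0` there)
  have hH : ∀ q ∈ K, ContDiffAt ℝ ∞ (fun q : ℝ × E4 ↦ Kerr.scalarH M q.1 q.2) q :=
    fun q hq ↦ Kerr.contDiffAt_scalarH_comp contDiffAt_const contDiffAt_fst contDiffAt_snd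
      (hKpos q hq)
  have hℓ : ∀ μ : Fin 4, ∀ q ∈ K,
      ContDiffAt ℝ ∞ (fun q : ℝ × E4 ↦ Kerr.nullCovectorFun q.1 q.2 μ) q :=
    fun μ q hq ↦ Kerr.contDiffAt_nullCovectorFun_comp contDiffAt_fst contDiffAt_snd (hKpos q hq) μ
  -- bounds for each order and each component
  have hbH : ∀ j : ℕ, ∃ C : ℝ, ∀ q ∈ K,
      ‖iteratedFDeriv ℝ j (fun q : ℝ × E4 ↦ Kerr.scalarH M q.1 q.2) q‖ ≤ C :=
    fun j ↦ exists_bound_iteratedFDeriv hKc hH j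
  have hbℓ : ∀ (j : ℕ) (μ : Fin 4), ∃ C : ℝ, ∀ q ∈ K,
      ‖iteratedFDeriv ℝ j (fun q : ℝ × E4 ↦ Kerr.nullCovectorFun q.1 q.2 μ) q‖ ≤ C :=
    fun j μ ↦ exists_bound_iteratedFDeriv hKc (hℓ μ) j
  choose CH hCH using hbH
  choose Cℓ hCℓ using hbℓ
  -- one constant: `max 1` of the sum of all the (absolute values of the) individual bounds
  refine ⟨max 1 (∑ i ∈ Finset.range (n + 1), (|CH i| + ∑ ν, |Cℓ i ν|)), le_max_left _ _, ?_⟩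
  intro a ha x hx0 hx1 hx2 j hj
  have hq : (a, x) ∈ K := hKmem a ha x hx0 hx1 hx2
  have hjmem : j ∈ Finset.range (n + 1) := Finset.mem_range.2 (Nat.lt_succ_of_le hj)
  have hsum : |CH j| + ∑ ν, |Cℓ j ν| ≤ ∑ i ∈ Finset.range (n + 1), (|CH i| + ∑ ν, |Cℓ i ν|) :=
    Finset.single_le_sum (f := fun i ↦ |CH i| + ∑ ν, |Cℓ i ν|)
      (fun i _ ↦ by positivity) hjmem
  refine ⟨?_, fun μ ↦ ?_⟩
  · calc ‖iteratedFDeriv ℝ j (fun q : ℝ × E4 ↦ Kerr.scalarH M q.1 q.2) (a, x)‖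
        ≤ CH j := hCH j _ hq
      _ ≤ |CH j| := le_abs_self _
      _ ≤ |CH j| + ∑ ν, |Cℓ j ν| := le_add_of_nonneg_right (by positivity)
      _ ≤ ∑ i ∈ Finset.range (n + 1), (|CH i| + ∑ ν, |Cℓ i ν|) := hsum
      _ ≤ _ := le_max_right _ _
  · calc ‖iteratedFDeriv ℝ j (fun q : ℝ × E4 ↦ Kerr.nullCovectorFun q.1 q.2 μ) (a, x)‖
        ≤ Cℓ j μ := hCℓ j μ _ hq
      _ ≤ |Cℓ j μ| := le_abs_self _
      _ ≤ ∑ ν, |Cℓ j ν| :=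
        Finset.single_le_sum (f := fun ν ↦ |Cℓ j ν|) (fun ν _ ↦ abs_nonneg _)
          (Finset.mem_univ μ)
      _ ≤ |CH j| + ∑ ν, |Cℓ j ν| := le_add_of_nonneg_left (abs_nonneg _)
      _ ≤ ∑ i ∈ Finset.range (n + 1), (|CH i| + ∑ ν, |Cℓ i ν|) := hsum
      _ ≤ _ := le_max_right _ _

end Summit.FinalStateConjecture.FinalStateConjecture.Theorems.NearExtremalKappaCapture.PolynomialClosure
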